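import Literature.Barriers.ValiantsHypothesis.BIJL18ClauseGadgetProofs
import HarnessLib

/-!
# Bläser–Ikenmeyer–Jindal–Lysikov 2018, Lemma 22: the completion rank of `T_φ` —
part (1) PROVED, part (2) REFUTED as printed (`not_BIJL2018_lemma22`)

Sibling proofs file of `BIJL18MatrixCompletion.lean` (val-lit row BIJL2018-A; M. Bläser,
C. Ikenmeyer, G. Jindal, V. Lysikov, *Generalized matrix completion and algebraic natural proofs*,
STOC 2018 / ECCC TR18-064, §5, Lemma 22, [cite: BlaserIkenmeyerJindalLysikov2018, Lemma 22]).
`T_φ = (tphiA₀, tphiSlices)` is the §5 tensor of a 3-CNF `φ` with `s` clauses over `t`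
variables: block diagonal `9 × 9` clause gadgets (`gadget₉`, Lemma 21), one rank-one slice per
formula variable `x` (ones on all (variable row of an occurrence of `x`) × (variable column of an
occurrence of `x`)), nine local slices per clause, and one auxiliary matrix unit `x_{h,ℓ}` per
ordered pair `h ≠ ℓ` of occurrences of the same variable.

## Results

* `Lemma22.pencilEval_tphi_eq` — **the decomposition**: for arbitrary variable values `cv`,
  arbitrary *virtual slot values* `ξ : slots → K`, the Lemma-21 locals `u = ξ_h, u₁ = s(u),
  u₂ = u` (etc.) and the auxiliary values `x_{h,ℓ} ↦ -ξ_h`, the pencil `A₀ + Σ_k c_k A_k` equals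
  `blockdiag_j gadget₉(ξ-values of clause j) + Σ_x (cv x - ξ on the x-rows) ⊗ (𝟙 on the x-columns)`.
* `completionRank_tphi_le` — **`CR(T_φ) ≤ 5 s + t` for EVERY 3-CNF `φ`**: take `cv = 0` and let
  every slot virtually satisfy its own literal (`ξ_h = 1` for a positive literal, `0` for a
  negative one); every block then has rank `5` (Lemma 21 (1), `Lemma21.rank_gadget₉_eq_five`) and
  the correction is a sum of `t` rank-one matrices.
* `completionRank_tphi_le_of_satisfiable` — **Lemma 22 (1) PROVED**: a satisfying assignment
  gives `CR(T_φ) ≤ 5 s` (virtual values = actual values, correction `= 0`).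
* `not_BIJL2018_lemma22` — **the typed named fact `BIJL2018_lemma22 K` is FALSE for every field
  `K`** (its part (2)): `φ₄ = [x∨x∨x, x∨x∨x, ¬x∨¬x∨¬x, ¬x∨¬x∨¬x]` (`t = 1`, `s = 4`), `ε = 1/2`:
  every Boolean assignment satisfies exactly `2 = (1 - ε) s` clauses, part (2) demands
  `(5 + ε) s = 22 ≤ CR(T_{φ₄})`, while `CR(T_{φ₄}) ≤ 21`.

## Erratum note (honest framing)

The typed fact transcribes the printed Lemma 22 faithfully (val-lit referee lanes FAITHFUL on the
statement file); what fails is the PRINT, read for the `T_φ` of an arbitrary 3-CNF: the printed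
proof of (2) (ECCC p. 16, "choose linearly independent columns … exchange … every gadget with only
five columns among them is satisfied") overlooks that the auxiliary variables let every clause
gadget take *virtual* satisfying values at total extra cost one rank-one matrix per formula
variable, so `CR(T_φ) ≤ 5 s + t` always. Under the bounded-occurrence promise of the source
problem of Thm. 20 (each variable in at most `c` clauses, hence `t ≥ 3 s / c`) this upper bound
does not contradict (2) when `ε ≤ 3 / c`; whether (2) holds in that regime is NOT decided here,
and BIJL Thm. 23 (NP-hardness of approximating tensor rank) is independently [SWZ17] as the paper
itself notes. Nothing in this file bears on `VP ≠ VNP`.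

Theorem-only file (no definitions); the assignment, the block matrix and the correction are
written as explicit terms. The block identity (`Lemma22.block_identity`) is checked row by row
(`fin_cases` on the `9 × 9` positions).

## References
* [BlaserIkenmeyerJindalLysikov2018] M. Bläser, C. Ikenmeyer, G. Jindal, V. Lysikov, STOC 2018,
  doi:10.1145/3188745.3188832; ECCC TR18-064, §5: construction of `T_φ` (p. 15–16), Lemma 21,
  Lemma 22 and its printed proof (p. 16), Thm. 20, Thm. 23.
* [SWZ17] Z. Song, D. Woodruff, P. Zhong, *Relative error tensor low rank approximation*,
  arXiv:1704.08246 (independent NP-hardness of approximating tensor rank, cited by BIJL).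
-/

noncomputable section

namespace Literature.Barriers.ValiantsHypothesis

open Matrix Literature.Computability.Complexity

universe u

variable {K : Type u} [Field K]

namespace Lemma22

variable {t : ℕ}

/-- Pulling a constant condition out of a finite sum. [folklore] -/
private theorem sum_ite_const_cond {ι : Type*} (s : Finset ι) (c : Prop) [Decidable c] (f : ι → K) :
    (∑ i ∈ s, if c then f i else 0) = if c then ∑ i ∈ s, f i else 0 := by
  split_ifs <;> simp

/-- A sum over a subtype of a finite type, as an indicator sum. [folklore] -/
private theorem sum_subtype_univ_eq {α : Type*} [Fintype α] (P : α → Prop) [DecidablePred P] (f : α → K) :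
    (∑ y : {a // P a}, f y.1) = ∑ x, if P x then f x else 0 := by
  rw [← Finset.subtype_univ P, Finset.sum_subtype_eq_sum_filter, Finset.sum_filter]

/-- Closed form of the local-variable part of the pencil (slices `(j, a, wh)`): supported on the
diagonal blocks. [cite: BlaserIkenmeyerJindalLysikov2018, §5 (construction of `T_φ`)] -/
theorem sloc_apply (φ : List (Clause₃ t)) (L : Fin φ.length × Fin 3 × Fin 3 → K)
    (p q : Fin φ.length × Fin 9) :
    (∑ y : Fin φ.length × Fin 3 × Fin 3, L y * tphiSlices K φ (Sum.inr (Sum.inl y)) p q) =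
      if p.1 = q.1 then ∑ a : Fin 3, ∑ wh : Fin 3, L (p.1, a, wh) *
        (if wh = 0 then
          (if (p.2 = varCol a ∨ p.2 = clauseRow a) then
            (if q.2 = varCol a then 1 else if q.2 = clauseRow a then
              (if ((φ.get p.1).lit a).2 then -1 else 1) else 0) else 0)
         else if wh = 1 then (if p.2 = varCol a ∧ q.2 = clauseRow a then -1 else 0)
         else (if p.2 = clauseRow a ∧ q.2 = varCol a then -1 else 0))
      else 0 := by
  simp_rw [Fintype.sum_prod_type]
  simp only [tphiSlices]
  simp_rw [mul_ite, mul_zero, sum_ite_const_cond, ite_and]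
  rw [Finset.sum_ite_eq]
  simp only [Finset.mem_univ, if_true]
  by_cases h : p.1 = q.1
  · rw [if_pos h, if_pos h.symm, h]
  · rw [if_neg h, if_neg (Ne.symm h)]

/-- The auxiliary slice of the pair of occurrences `(h, l)` is the matrix unit at
(variable row of `h`, variable column of `l`). [cite: BlaserIkenmeyerJindalLysikov2018, §5] -/
theorem tphiSlices_aux_apply (φ : List (Clause₃ t))
    (σ : Σ x : Fin t, {pp : Occ φ x × Occ φ x // pp.1 ≠ pp.2}) (p q : Fin φ.length × Fin 9) :
    tphiSlices K φ (Sum.inr (Sum.inr σ)) p q =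
      if p = (σ.2.1.1.1.1, varRow σ.2.1.1.1.2) ∧ q = (σ.2.1.2.1.1, varCol σ.2.1.2.1.2)
      then 1 else 0 := by
  obtain ⟨x, ⟨⟨h, l⟩, hne⟩⟩ := σ
  rfl

/-- Summation over the occurrences of `x`, as a filtered sum over all slots. [folklore] -/
private theorem sum_occ_eq (φ : List (Clause₃ t)) (x : Fin t) (g : Fin φ.length × Fin 3 → K) :
    (∑ h : Occ φ x, g h.1) =
      ∑ h : Fin φ.length × Fin 3, if ((φ.get h.1).lit h.2).1 = x then g h else 0 :=
  sum_subtype_univ_eq _ g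

/-- Summation over the auxiliary index set, as a double sum over slots.
[cite: BlaserIkenmeyerJindalLysikov2018, §5 (construction of `T_φ`)] -/
theorem sum_aux_eq (φ : List (Clause₃ t)) (G : Fin φ.length × Fin 3 → Fin φ.length × Fin 3 → K) :
    (∑ σ : (Σ x : Fin t, {pp : Occ φ x × Occ φ x // pp.1 ≠ pp.2}), G σ.2.1.1.1 σ.2.1.2.1) =
      ∑ h : Fin φ.length × Fin 3, ∑ l : Fin φ.length × Fin 3,
        if ((φ.get l.1).lit l.2).1 = ((φ.get h.1).lit h.2).1 ∧ h ≠ l then G h l else 0 := by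
  classical
  rw [Fintype.sum_sigma]
  have step1 : ∀ x : Fin t,
      (∑ y : {pp : Occ φ x × Occ φ x // pp.1 ≠ pp.2}, G y.1.1.1 y.1.2.1) =
        ∑ h : Occ φ x, ∑ l : Occ φ x, if h.1 ≠ l.1 then G h.1 l.1 else 0 := by
    intro x
    have e := sum_subtype_univ_eq (fun pp : Occ φ x × Occ φ x => pp.1 ≠ pp.2)
      (fun pp => G pp.1.1 pp.2.1)
    rw [e, Fintype.sum_prod_type]
    refine Finset.sum_congr rfl fun h _ => Finset.sum_congr rfl fun l _ => ?_
    have : (h ≠ l) ↔ (h.1 ≠ l.1) := by rw [Ne, Ne, Subtype.ext_iff]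
    simp only [this]
  have step2 : ∀ (x : Fin t) (h : Occ φ x),
      (∑ l : Occ φ x, if h.1 ≠ l.1 then G h.1 l.1 else 0) =
        ∑ l : Fin φ.length × Fin 3,
          if ((φ.get l.1).lit l.2).1 = ((φ.get h.1.1).lit h.1.2).1 ∧ h.1 ≠ l then G h.1 l else 0 := by
    intro x h
    have e := sum_occ_eq φ x (fun l => if h.1 ≠ l then G h.1 l else 0)
    rw [e]
    refine Finset.sum_congr rfl fun l _ => ?_
    rw [h.2, ite_and]
  simp_rw [step1, step2]
  exact Fintype.sum_fiberwise (fun h : Fin φ.length × Fin 3 => ((φ.get h.1).lit h.2).1)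
    (fun h => ∑ l : Fin φ.length × Fin 3,
      if ((φ.get l.1).lit l.2).1 = ((φ.get h.1).lit h.2).1 ∧ h ≠ l then G h l else 0)

/-- Collapsing a sum over slots against "`p` is the variable row of the slot". [folklore] -/
private theorem sum_slot_row (φ : List (Clause₃ t)) (p : Fin φ.length × Fin 9) (g : Fin φ.length × Fin 3 → K) :
    (∑ h : Fin φ.length × Fin 3, if p = (h.1, varRow h.2) then g h else 0) =
      ∑ a : Fin 3, if p.2 = varRow a then g (p.1, a) else 0 := by
  rw [Fintype.sum_prod_type, Finset.sum_comm]
  refine Finset.sum_congr rfl fun a _ => ?_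
  simp_rw [Prod.ext_iff]
  simp only [ite_and]
  rw [Finset.sum_ite_eq]
  simp

/-- Collapsing a sum over slots against "`q` is the variable column of the slot". [folklore] -/
private theorem sum_slot_col (φ : List (Clause₃ t)) (q : Fin φ.length × Fin 9) (g : Fin φ.length × Fin 3 → K) :
    (∑ l : Fin φ.length × Fin 3, if q = (l.1, varCol l.2) then g l else 0) =
      ∑ a : Fin 3, if q.2 = varCol a then g (q.1, a) else 0 := by
  rw [Fintype.sum_prod_type, Finset.sum_comm]
  refine Finset.sum_congr rfl fun a _ => ?_
  simp_rw [Prod.ext_iff]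
  simp only [ite_and]
  rw [Finset.sum_ite_eq]
  simp

/-- Rank is subadditive (matrices over a field). [folklore] -/
private theorem rank_add_le {m n : Type*} [Fintype m] [Fintype n] (A B : Matrix m n K) :
    (A + B).rank ≤ A.rank + B.rank := by
  unfold Matrix.rank
  rw [Matrix.mulVecLin_add]
  exact (Submodule.finrank_mono (LinearMap.range_add_le _ _)).trans
    (Submodule.finrank_add_le_finrank_add_finrank _ _)

/-- Rank of a finite sum is at most the sum of the ranks. [folklore] -/
private theorem rank_sum_le {ι m n : Type*} [Fintype m] [Fintype n] (s : Finset ι)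
    (M : ι → Matrix m n K) : (∑ i ∈ s, M i).rank ≤ ∑ i ∈ s, (M i).rank :=
  Finset.le_sum_of_subadditive (fun A : Matrix m n K => A.rank) Matrix.rank_zero.le
    (fun A B => rank_add_le A B) s M

/-- `∃` over `Fin 3`, spelled out. [folklore] -/
private theorem exists_fin3 {P : Fin 3 → Prop} : (∃ a, P a) ↔ P 0 ∨ P 1 ∨ P 2 := by
  constructor
  · rintro ⟨a, ha⟩
    fin_cases a
    · exact Or.inl ha
    · exact Or.inr (Or.inl ha)
    · exact Or.inr (Or.inr ha)
  · rintro (h | h | h) <;> exact ⟨_, h⟩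

/-- `r = varRow a` on values. [cite: BlaserIkenmeyerJindalLysikov2018, §5] -/
theorem eq_varRow_iff (r : Fin 9) (a : Fin 3) : r = varRow a ↔ (r : ℕ) = 2 * (a : ℕ) := by
  simp [varRow, Fin.ext_iff]

/-- `r = varCol a` on values. [cite: BlaserIkenmeyerJindalLysikov2018, §5] -/
theorem eq_varCol_iff (r : Fin 9) (a : Fin 3) : r = varCol a ↔ (r : ℕ) = 2 * (a : ℕ) + 1 := by
  simp [varCol, Fin.ext_iff]

/-- `r = clauseRow a` on values. [cite: BlaserIkenmeyerJindalLysikov2018, §5] -/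
theorem eq_clauseRow_iff (r : Fin 9) (a : Fin 3) : r = clauseRow a ↔ (r : ℕ) = 6 + (a : ℕ) := by
  simp [clauseRow, Fin.ext_iff]

/-- The indicator of "`r` is the variable row of a slot satisfying `P`" as a sum over the
three slots (`varRow` is injective). [cite: BlaserIkenmeyerJindalLysikov2018, §5 (construction of `T_φ`)] -/
theorem ite_exists_varRow (P : Fin 3 → Prop) [DecidablePred P] (r : Fin 9) (y : K) :
    (if ∃ a, P a ∧ r = varRow a then y else 0) = ∑ a, if r = varRow a ∧ P a then y else 0 := by
  fin_cases r <;> simp [exists_fin3, Fin.sum_univ_three, eq_varRow_iff]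

/-- The indicator of "`r` is the variable column of a slot satisfying `P`" as a sum over the
three slots (`varCol` is injective). [cite: BlaserIkenmeyerJindalLysikov2018, §5 (construction of `T_φ`)] -/
theorem ite_exists_varCol (P : Fin 3 → Prop) [DecidablePred P] (r : Fin 9) (y : K) :
    (if ∃ a, P a ∧ r = varCol a then y else 0) = ∑ a, if r = varCol a ∧ P a then y else 0 := by
  fin_cases r <;> simp [exists_fin3, Fin.sum_univ_three, eq_varCol_iff]

/-- The indicator of a conjunction is the product of the indicators. [folklore] -/
private theorem ite_and_one_zero (A B : Prop) [Decidable A] [Decidable B] :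
    (if A ∧ B then (1 : K) else 0) = (if A then 1 else 0) * (if B then 1 else 0) := by
  split_ifs <;> simp_all

/-- Collapsing `Σ_x f x · [A ∧ v = x] · [B ∧ w = x]`. [folklore] -/
private theorem sum_mul_ite_eq_ite_eq (f : Fin t → K) (v w : Fin t) (A B : Prop) [Decidable A]
    [Decidable B] :
    (∑ x, f x * ((if A ∧ v = x then (1 : K) else 0) * (if B ∧ w = x then 1 else 0))) =
      if A ∧ B ∧ w = v then f v else 0 := by
  by_cases hA : A
  · by_cases hB : B
    · simp only [hA, hB, true_and]
      rw [Finset.sum_eq_single v]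
      · simp [eq_comm]
      · intro x _ hx
        simp [Ne.symm hx]
      · simp
    · simp [hB]
  · simp [hA]

/-- Closed form of the formula-variable part of the pencil: the slices `Sum.inl x` contribute
`cv(x)` at every position (variable row of an occurrence of `x`, variable column of an occurrence
of `x`). [cite: BlaserIkenmeyerJindalLysikov2018, §5 (construction of `T_φ`)] -/
theorem svar_apply (φ : List (Clause₃ t)) (cv : Fin t → K) (p q : Fin φ.length × Fin 9) :
    (∑ x, cv x * tphiSlices K φ (Sum.inl x) p q) =
      ∑ a : Fin 3, ∑ a' : Fin 3,
        if p.2 = varRow a ∧ q.2 = varCol a' ∧ ((φ.get q.1).lit a').1 = ((φ.get p.1).lit a).1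
        then cv ((φ.get p.1).lit a).1 else 0 := by
  have h1 : ∀ x, tphiSlices K φ (Sum.inl x) p q =
      (∑ a : Fin 3, if p.2 = varRow a ∧ ((φ.get p.1).lit a).1 = x then (1 : K) else 0) *
      (∑ a' : Fin 3, if q.2 = varCol a' ∧ ((φ.get q.1).lit a').1 = x then (1 : K) else 0) := by
    intro x
    simp only [tphiSlices]
    rw [ite_and_one_zero, ite_exists_varRow, ite_exists_varCol]
  simp_rw [h1, Finset.sum_mul_sum, Finset.mul_sum]
  rw [Finset.sum_comm]
  refine Finset.sum_congr rfl fun a _ => ?_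
  rw [Finset.sum_comm]
  refine Finset.sum_congr rfl fun a' _ => ?_
  exact sum_mul_ite_eq_ite_eq cv _ _ _ _

/-- Block identity, row 0. [cite: BlaserIkenmeyerJindalLysikov2018, §5 (construction of `T_φ`)] -/
theorem block_identity_row0 (pol : Fin 3 → Bool) (ξ : Fin 3 → K) (r' : Fin 9) :
    let r : Fin 9 := 0
    ((if (∃ a : Fin 3, (r = varRow a ∨ r = varCol a) ∧ r' = varRow a) then (1 : K)
       else if (r = 6 ∧ r' = 7) ∨ (r = 7 ∧ r' = 8) then 1
       else if (∃ a : Fin 3, r = clauseRow a ∧ r' = clauseRow a ∧ pol a = true) then 1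
       else 0) +
      (∑ a : Fin 3, ∑ wh : Fin 3, (if wh = 1 then gs K (pol a) (ξ a) else ξ a) *
        (if wh = 0 then
          (if (r = varCol a ∨ r = clauseRow a) then
            (if r' = varCol a then 1 else if r' = clauseRow a then
              (if pol a then -1 else 1) else 0) else 0)
         else if wh = 1 then (if r = varCol a ∧ r' = clauseRow a then -1 else 0)
         else (if r = clauseRow a ∧ r' = varCol a then -1 else 0))) +
      (∑ a : Fin 3, if r = varRow a ∧ r' = varCol a then ξ a else 0)) =
    gadget₉ K (pol 0) (pol 1) (pol 2) (ξ 0) (ξ 1) (ξ 2) (ξ 0) (ξ 1) (ξ 2)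
      (gs K (pol 0) (ξ 0)) (ξ 0) (gs K (pol 1) (ξ 1)) (ξ 1) (gs K (pol 2) (ξ 2)) (ξ 2) r r' := by
  intro r
  fin_cases r' <;>
    simp [r, gadget₉, Fin.sum_univ_three, exists_fin3, eq_varRow_iff, eq_varCol_iff,
      eq_clauseRow_iff, gs, gl]

/-- Block identity, row 1. [cite: BlaserIkenmeyerJindalLysikov2018, §5 (construction of `T_φ`)] -/
theorem block_identity_row1 (pol : Fin 3 → Bool) (ξ : Fin 3 → K) (r' : Fin 9) :
    let r : Fin 9 := 1
    ((if (∃ a : Fin 3, (r = varRow a ∨ r = varCol a) ∧ r' = varRow a) then (1 : K)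
       else if (r = 6 ∧ r' = 7) ∨ (r = 7 ∧ r' = 8) then 1
       else if (∃ a : Fin 3, r = clauseRow a ∧ r' = clauseRow a ∧ pol a = true) then 1
       else 0) +
      (∑ a : Fin 3, ∑ wh : Fin 3, (if wh = 1 then gs K (pol a) (ξ a) else ξ a) *
        (if wh = 0 then
          (if (r = varCol a ∨ r = clauseRow a) then
            (if r' = varCol a then 1 else if r' = clauseRow a then
              (if pol a then -1 else 1) else 0) else 0)
         else if wh = 1 then (if r = varCol a ∧ r' = clauseRow a then -1 else 0)
         else (if r = clauseRow a ∧ r' = varCol a then -1 else 0))) +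
      (∑ a : Fin 3, if r = varRow a ∧ r' = varCol a then ξ a else 0)) =
    gadget₉ K (pol 0) (pol 1) (pol 2) (ξ 0) (ξ 1) (ξ 2) (ξ 0) (ξ 1) (ξ 2)
      (gs K (pol 0) (ξ 0)) (ξ 0) (gs K (pol 1) (ξ 1)) (ξ 1) (gs K (pol 2) (ξ 2)) (ξ 2) r r' := by
  intro r
  fin_cases r' <;>
    simp [r, gadget₉, Fin.sum_univ_three, exists_fin3, eq_varRow_iff, eq_varCol_iff,
      eq_clauseRow_iff, gs, gl]

/-- Block identity, row 2. [cite: BlaserIkenmeyerJindalLysikov2018, §5 (construction of `T_φ`)] -/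
theorem block_identity_row2 (pol : Fin 3 → Bool) (ξ : Fin 3 → K) (r' : Fin 9) :
    let r : Fin 9 := 2
    ((if (∃ a : Fin 3, (r = varRow a ∨ r = varCol a) ∧ r' = varRow a) then (1 : K)
       else if (r = 6 ∧ r' = 7) ∨ (r = 7 ∧ r' = 8) then 1
       else if (∃ a : Fin 3, r = clauseRow a ∧ r' = clauseRow a ∧ pol a = true) then 1
       else 0) +
      (∑ a : Fin 3, ∑ wh : Fin 3, (if wh = 1 then gs K (pol a) (ξ a) else ξ a) *
        (if wh = 0 then
          (if (r = varCol a ∨ r = clauseRow a) then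
            (if r' = varCol a then 1 else if r' = clauseRow a then
              (if pol a then -1 else 1) else 0) else 0)
         else if wh = 1 then (if r = varCol a ∧ r' = clauseRow a then -1 else 0)
         else (if r = clauseRow a ∧ r' = varCol a then -1 else 0))) +
      (∑ a : Fin 3, if r = varRow a ∧ r' = varCol a then ξ a else 0)) =
    gadget₉ K (pol 0) (pol 1) (pol 2) (ξ 0) (ξ 1) (ξ 2) (ξ 0) (ξ 1) (ξ 2)
      (gs K (pol 0) (ξ 0)) (ξ 0) (gs K (pol 1) (ξ 1)) (ξ 1) (gs K (pol 2) (ξ 2)) (ξ 2) r r' := by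
  intro r
  fin_cases r' <;>
    simp [r, gadget₉, Fin.sum_univ_three, exists_fin3, eq_varRow_iff, eq_varCol_iff,
      eq_clauseRow_iff, gs, gl]

/-- Block identity, row 3. [cite: BlaserIkenmeyerJindalLysikov2018, §5 (construction of `T_φ`)] -/
theorem block_identity_row3 (pol : Fin 3 → Bool) (ξ : Fin 3 → K) (r' : Fin 9) :
    let r : Fin 9 := 3
    ((if (∃ a : Fin 3, (r = varRow a ∨ r = varCol a) ∧ r' = varRow a) then (1 : K)
       else if (r = 6 ∧ r' = 7) ∨ (r = 7 ∧ r' = 8) then 1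
       else if (∃ a : Fin 3, r = clauseRow a ∧ r' = clauseRow a ∧ pol a = true) then 1
       else 0) +
      (∑ a : Fin 3, ∑ wh : Fin 3, (if wh = 1 then gs K (pol a) (ξ a) else ξ a) *
        (if wh = 0 then
          (if (r = varCol a ∨ r = clauseRow a) then
            (if r' = varCol a then 1 else if r' = clauseRow a then
              (if pol a then -1 else 1) else 0) else 0)
         else if wh = 1 then (if r = varCol a ∧ r' = clauseRow a then -1 else 0)
         else (if r = clauseRow a ∧ r' = varCol a then -1 else 0))) +
      (∑ a : Fin 3, if r = varRow a ∧ r' = varCol a then ξ a else 0)) =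
    gadget₉ K (pol 0) (pol 1) (pol 2) (ξ 0) (ξ 1) (ξ 2) (ξ 0) (ξ 1) (ξ 2)
      (gs K (pol 0) (ξ 0)) (ξ 0) (gs K (pol 1) (ξ 1)) (ξ 1) (gs K (pol 2) (ξ 2)) (ξ 2) r r' := by
  intro r
  fin_cases r' <;>
    simp [r, gadget₉, Fin.sum_univ_three, exists_fin3, eq_varRow_iff, eq_varCol_iff,
      eq_clauseRow_iff, gs, gl]

/-- Block identity, row 4. [cite: BlaserIkenmeyerJindalLysikov2018, §5 (construction of `T_φ`)] -/
theorem block_identity_row4 (pol : Fin 3 → Bool) (ξ : Fin 3 → K) (r' : Fin 9) :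
    let r : Fin 9 := 4
    ((if (∃ a : Fin 3, (r = varRow a ∨ r = varCol a) ∧ r' = varRow a) then (1 : K)
       else if (r = 6 ∧ r' = 7) ∨ (r = 7 ∧ r' = 8) then 1
       else if (∃ a : Fin 3, r = clauseRow a ∧ r' = clauseRow a ∧ pol a = true) then 1
       else 0) +
      (∑ a : Fin 3, ∑ wh : Fin 3, (if wh = 1 then gs K (pol a) (ξ a) else ξ a) *
        (if wh = 0 then
          (if (r = varCol a ∨ r = clauseRow a) then
            (if r' = varCol a then 1 else if r' = clauseRow a then
              (if pol a then -1 else 1) else 0) else 0)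
         else if wh = 1 then (if r = varCol a ∧ r' = clauseRow a then -1 else 0)
         else (if r = clauseRow a ∧ r' = varCol a then -1 else 0))) +
      (∑ a : Fin 3, if r = varRow a ∧ r' = varCol a then ξ a else 0)) =
    gadget₉ K (pol 0) (pol 1) (pol 2) (ξ 0) (ξ 1) (ξ 2) (ξ 0) (ξ 1) (ξ 2)
      (gs K (pol 0) (ξ 0)) (ξ 0) (gs K (pol 1) (ξ 1)) (ξ 1) (gs K (pol 2) (ξ 2)) (ξ 2) r r' := by
  intro r
  fin_cases r' <;>
    simp [r, gadget₉, Fin.sum_univ_three, exists_fin3, eq_varRow_iff, eq_varCol_iff,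
      eq_clauseRow_iff, gs, gl]

/-- Block identity, row 5. [cite: BlaserIkenmeyerJindalLysikov2018, §5 (construction of `T_φ`)] -/
theorem block_identity_row5 (pol : Fin 3 → Bool) (ξ : Fin 3 → K) (r' : Fin 9) :
    let r : Fin 9 := 5
    ((if (∃ a : Fin 3, (r = varRow a ∨ r = varCol a) ∧ r' = varRow a) then (1 : K)
       else if (r = 6 ∧ r' = 7) ∨ (r = 7 ∧ r' = 8) then 1
       else if (∃ a : Fin 3, r = clauseRow a ∧ r' = clauseRow a ∧ pol a = true) then 1
       else 0) +
      (∑ a : Fin 3, ∑ wh : Fin 3, (if wh = 1 then gs K (pol a) (ξ a) else ξ a) *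
        (if wh = 0 then
          (if (r = varCol a ∨ r = clauseRow a) then
            (if r' = varCol a then 1 else if r' = clauseRow a then
              (if pol a then -1 else 1) else 0) else 0)
         else if wh = 1 then (if r = varCol a ∧ r' = clauseRow a then -1 else 0)
         else (if r = clauseRow a ∧ r' = varCol a then -1 else 0))) +
      (∑ a : Fin 3, if r = varRow a ∧ r' = varCol a then ξ a else 0)) =
    gadget₉ K (pol 0) (pol 1) (pol 2) (ξ 0) (ξ 1) (ξ 2) (ξ 0) (ξ 1) (ξ 2)
      (gs K (pol 0) (ξ 0)) (ξ 0) (gs K (pol 1) (ξ 1)) (ξ 1) (gs K (pol 2) (ξ 2)) (ξ 2) r r' := by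
  intro r
  fin_cases r' <;>
    simp [r, gadget₉, Fin.sum_univ_three, exists_fin3, eq_varRow_iff, eq_varCol_iff,
      eq_clauseRow_iff, gs, gl]

/-- Block identity, row 6. [cite: BlaserIkenmeyerJindalLysikov2018, §5 (construction of `T_φ`)] -/
theorem block_identity_row6 (pol : Fin 3 → Bool) (ξ : Fin 3 → K) (r' : Fin 9) :
    let r : Fin 9 := 6
    ((if (∃ a : Fin 3, (r = varRow a ∨ r = varCol a) ∧ r' = varRow a) then (1 : K)
       else if (r = 6 ∧ r' = 7) ∨ (r = 7 ∧ r' = 8) then 1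
       else if (∃ a : Fin 3, r = clauseRow a ∧ r' = clauseRow a ∧ pol a = true) then 1
       else 0) +
      (∑ a : Fin 3, ∑ wh : Fin 3, (if wh = 1 then gs K (pol a) (ξ a) else ξ a) *
        (if wh = 0 then
          (if (r = varCol a ∨ r = clauseRow a) then
            (if r' = varCol a then 1 else if r' = clauseRow a then
              (if pol a then -1 else 1) else 0) else 0)
         else if wh = 1 then (if r = varCol a ∧ r' = clauseRow a then -1 else 0)
         else (if r = clauseRow a ∧ r' = varCol a then -1 else 0))) +
      (∑ a : Fin 3, if r = varRow a ∧ r' = varCol a then ξ a else 0)) =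
    gadget₉ K (pol 0) (pol 1) (pol 2) (ξ 0) (ξ 1) (ξ 2) (ξ 0) (ξ 1) (ξ 2)
      (gs K (pol 0) (ξ 0)) (ξ 0) (gs K (pol 1) (ξ 1)) (ξ 1) (gs K (pol 2) (ξ 2)) (ξ 2) r r' := by
  intro r
  fin_cases r' <;>
    simp [r, gadget₉, Fin.sum_univ_three, exists_fin3, eq_varRow_iff, eq_varCol_iff,
      eq_clauseRow_iff, gs, gl]
  split_ifs <;> ring

/-- Block identity, row 7. [cite: BlaserIkenmeyerJindalLysikov2018, §5 (construction of `T_φ`)] -/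
theorem block_identity_row7 (pol : Fin 3 → Bool) (ξ : Fin 3 → K) (r' : Fin 9) :
    let r : Fin 9 := 7
    ((if (∃ a : Fin 3, (r = varRow a ∨ r = varCol a) ∧ r' = varRow a) then (1 : K)
       else if (r = 6 ∧ r' = 7) ∨ (r = 7 ∧ r' = 8) then 1
       else if (∃ a : Fin 3, r = clauseRow a ∧ r' = clauseRow a ∧ pol a = true) then 1
       else 0) +
      (∑ a : Fin 3, ∑ wh : Fin 3, (if wh = 1 then gs K (pol a) (ξ a) else ξ a) *
        (if wh = 0 then
          (if (r = varCol a ∨ r = clauseRow a) then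
            (if r' = varCol a then 1 else if r' = clauseRow a then
              (if pol a then -1 else 1) else 0) else 0)
         else if wh = 1 then (if r = varCol a ∧ r' = clauseRow a then -1 else 0)
         else (if r = clauseRow a ∧ r' = varCol a then -1 else 0))) +
      (∑ a : Fin 3, if r = varRow a ∧ r' = varCol a then ξ a else 0)) =
    gadget₉ K (pol 0) (pol 1) (pol 2) (ξ 0) (ξ 1) (ξ 2) (ξ 0) (ξ 1) (ξ 2)
      (gs K (pol 0) (ξ 0)) (ξ 0) (gs K (pol 1) (ξ 1)) (ξ 1) (gs K (pol 2) (ξ 2)) (ξ 2) r r' := by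
  intro r
  fin_cases r' <;>
    simp [r, gadget₉, Fin.sum_univ_three, exists_fin3, eq_varRow_iff, eq_varCol_iff,
      eq_clauseRow_iff, gs, gl]
  split_ifs <;> ring

/-- Block identity, row 8. [cite: BlaserIkenmeyerJindalLysikov2018, §5 (construction of `T_φ`)] -/
theorem block_identity_row8 (pol : Fin 3 → Bool) (ξ : Fin 3 → K) (r' : Fin 9) :
    let r : Fin 9 := 8
    ((if (∃ a : Fin 3, (r = varRow a ∨ r = varCol a) ∧ r' = varRow a) then (1 : K)
       else if (r = 6 ∧ r' = 7) ∨ (r = 7 ∧ r' = 8) then 1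
       else if (∃ a : Fin 3, r = clauseRow a ∧ r' = clauseRow a ∧ pol a = true) then 1
       else 0) +
      (∑ a : Fin 3, ∑ wh : Fin 3, (if wh = 1 then gs K (pol a) (ξ a) else ξ a) *
        (if wh = 0 then
          (if (r = varCol a ∨ r = clauseRow a) then
            (if r' = varCol a then 1 else if r' = clauseRow a then
              (if pol a then -1 else 1) else 0) else 0)
         else if wh = 1 then (if r = varCol a ∧ r' = clauseRow a then -1 else 0)
         else (if r = clauseRow a ∧ r' = varCol a then -1 else 0))) +
      (∑ a : Fin 3, if r = varRow a ∧ r' = varCol a then ξ a else 0)) =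
    gadget₉ K (pol 0) (pol 1) (pol 2) (ξ 0) (ξ 1) (ξ 2) (ξ 0) (ξ 1) (ξ 2)
      (gs K (pol 0) (ξ 0)) (ξ 0) (gs K (pol 1) (ξ 1)) (ξ 1) (gs K (pol 2) (ξ 2)) (ξ 2) r r' := by
  intro r
  fin_cases r' <;>
    simp [r, gadget₉, Fin.sum_univ_three, exists_fin3, eq_varRow_iff, eq_varCol_iff,
      eq_clauseRow_iff, gs, gl]
  split_ifs <;> ring

/-- **The block identity.** On a diagonal block, the constant slice, the local slices at the
Lemma-21 values `u = x̂, u₁ = s(u), u₂ = u` (etc.) and the diagonal variable entries `x̂, ŷ, ẑ`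
add up to the printed `9 × 9` gadget at the (virtual) values `x̂, ŷ, ẑ`.
[cite: BlaserIkenmeyerJindalLysikov2018, §5 (construction of `T_φ`), Lemma 21 (1)] -/
theorem block_identity (pol : Fin 3 → Bool) (ξ : Fin 3 → K) (r r' : Fin 9) :
    ((if (∃ a : Fin 3, (r = varRow a ∨ r = varCol a) ∧ r' = varRow a) then (1 : K)
       else if (r = 6 ∧ r' = 7) ∨ (r = 7 ∧ r' = 8) then 1
       else if (∃ a : Fin 3, r = clauseRow a ∧ r' = clauseRow a ∧ pol a = true) then 1
       else 0) +
      (∑ a : Fin 3, ∑ wh : Fin 3, (if wh = 1 then gs K (pol a) (ξ a) else ξ a) *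
        (if wh = 0 then
          (if (r = varCol a ∨ r = clauseRow a) then
            (if r' = varCol a then 1 else if r' = clauseRow a then
              (if pol a then -1 else 1) else 0) else 0)
         else if wh = 1 then (if r = varCol a ∧ r' = clauseRow a then -1 else 0)
         else (if r = clauseRow a ∧ r' = varCol a then -1 else 0))) +
      (∑ a : Fin 3, if r = varRow a ∧ r' = varCol a then ξ a else 0)) =
    gadget₉ K (pol 0) (pol 1) (pol 2) (ξ 0) (ξ 1) (ξ 2) (ξ 0) (ξ 1) (ξ 2)
      (gs K (pol 0) (ξ 0)) (ξ 0) (gs K (pol 1) (ξ 1)) (ξ 1) (gs K (pol 2) (ξ 2)) (ξ 2) r r' := by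
  fin_cases r
  exacts [block_identity_row0 pol ξ r', block_identity_row1 pol ξ r', block_identity_row2 pol ξ r',
    block_identity_row3 pol ξ r', block_identity_row4 pol ξ r', block_identity_row5 pol ξ r',
    block_identity_row6 pol ξ r', block_identity_row7 pol ξ r', block_identity_row8 pol ξ r']


/-! ### Closed forms of the auxiliary part and of the rank-one correction `W′` -/

/-- Closed form of the auxiliary part of the pencil at the assignment `x_{h,l} ↦ -ξ_h`.
[cite: BlaserIkenmeyerJindalLysikov2018, §5 (construction of `T_φ`)] -/
theorem saux_apply (φ : List (Clause₃ t)) (ξ : Fin φ.length × Fin 3 → K)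
    (p q : Fin φ.length × Fin 9) :
    (∑ σ : (Σ x : Fin t, {pp : Occ φ x × Occ φ x // pp.1 ≠ pp.2}),
        (-ξ σ.2.1.1.1) * tphiSlices K φ (Sum.inr (Sum.inr σ)) p q) =
      ∑ a : Fin 3, ∑ a' : Fin 3,
        if p.2 = varRow a ∧ q.2 = varCol a' ∧ ((φ.get q.1).lit a').1 = ((φ.get p.1).lit a).1 ∧
            (p.1, a) ≠ (q.1, a')
        then -ξ (p.1, a) else 0 := by
  simp_rw [tphiSlices_aux_apply]
  have e := sum_aux_eq φ (fun h l => (-ξ h) *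
    (if p = (h.1, varRow h.2) ∧ q = (l.1, varCol l.2) then (1 : K) else 0))
  rw [e]
  have form : ∀ h l : Fin φ.length × Fin 3,
      (if ((φ.get l.1).lit l.2).1 = ((φ.get h.1).lit h.2).1 ∧ h ≠ l then
        (-ξ h) * (if p = (h.1, varRow h.2) ∧ q = (l.1, varCol l.2) then (1 : K) else 0) else 0) =
      if p = (h.1, varRow h.2) then
        (if q = (l.1, varCol l.2) then
          (if ((φ.get l.1).lit l.2).1 = ((φ.get h.1).lit h.2).1 ∧ h ≠ l then -ξ h else 0)
        else 0) else 0 := by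
    intro h l
    by_cases hV : (((φ.get l.1).lit l.2).1 = ((φ.get h.1).lit h.2).1 ∧ h ≠ l)
    · by_cases hP : p = (h.1, varRow h.2)
      · by_cases hQ : q = (l.1, varCol l.2)
        · rw [if_pos hV, if_pos ⟨hP, hQ⟩, if_pos hP, if_pos hQ, if_pos hV, mul_one]
        · rw [if_pos hV, if_neg (fun h' => hQ h'.2), if_pos hP, if_neg hQ, mul_zero]
      · rw [if_pos hV, if_neg (fun h' => hP h'.1), if_neg hP, mul_zero]
    · simp only [hV, if_false, ite_self]
  simp_rw [form, sum_ite_const_cond]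
  rw [sum_slot_row]
  refine Finset.sum_congr rfl fun a _ => ?_
  by_cases hR : p.2 = varRow a
  · simp only [hR, if_true, true_and]
    rw [sum_slot_col]
    refine Finset.sum_congr rfl fun a' _ => ?_
    by_cases hC : q.2 = varCol a'
    · simp only [hC, if_true, true_and]
    · simp only [hC, if_false, false_and]
  · simp [hR]

/-- Closed form of the rank-`≤ t` correction `W′ = Σ_x (column vector on the `x`-rows) ⊗
(indicator of the `x`-columns)`. [cite: BlaserIkenmeyerJindalLysikov2018, §5 (construction of `T_φ`)] -/
theorem wcorr_apply (φ : List (Clause₃ t)) (cv : Fin t → K) (ξ : Fin φ.length × Fin 3 → K)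
    (p q : Fin φ.length × Fin 9) :
    (∑ x : Fin t, Matrix.vecMulVec
        (fun p : Fin φ.length × Fin 9 =>
          ∑ h : Occ φ x, if p = (h.1.1, varRow h.1.2) then cv x - ξ h.1 else 0)
        (fun q : Fin φ.length × Fin 9 =>
          ∑ l : Occ φ x, if q = (l.1.1, varCol l.1.2) then (1 : K) else 0)) p q =
      ∑ a : Fin 3, ∑ a' : Fin 3,
        if p.2 = varRow a ∧ q.2 = varCol a' ∧ ((φ.get q.1).lit a').1 = ((φ.get p.1).lit a).1
        then cv ((φ.get p.1).lit a).1 - ξ (p.1, a) else 0 := by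
  rw [Matrix.sum_apply]
  simp only [Matrix.vecMulVec_apply]
  have e1 : ∀ x : Fin t,
      (∑ h : Occ φ x, if p = (h.1.1, varRow h.1.2) then cv x - ξ h.1 else 0) =
        ∑ a : Fin 3, if p.2 = varRow a ∧ ((φ.get p.1).lit a).1 = x
          then cv x - ξ (p.1, a) else 0 := by
    intro x
    have e := sum_occ_eq φ x (fun h => if p = (h.1, varRow h.2) then cv x - ξ h else 0)
    rw [e]
    have : ∀ h : Fin φ.length × Fin 3,
        (if ((φ.get h.1).lit h.2).1 = x then (if p = (h.1, varRow h.2) then cv x - ξ h else 0)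
          else 0) =
        if p = (h.1, varRow h.2) then (if ((φ.get h.1).lit h.2).1 = x then cv x - ξ h else 0)
          else 0 := by
      intro h; split_ifs <;> rfl
    simp_rw [this]
    rw [sum_slot_row]
    simp_rw [ite_and]
  have e2 : ∀ x : Fin t,
      (∑ l : Occ φ x, if q = (l.1.1, varCol l.1.2) then (1 : K) else 0) =
        ∑ a' : Fin 3, if q.2 = varCol a' ∧ ((φ.get q.1).lit a').1 = x then (1 : K) else 0 := by
    intro x
    have e := sum_occ_eq φ x (fun l => if q = (l.1, varCol l.2) then (1 : K) else 0)
    rw [e]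
    have : ∀ l : Fin φ.length × Fin 3,
        (if ((φ.get l.1).lit l.2).1 = x then (if q = (l.1, varCol l.2) then (1 : K) else 0)
          else 0) =
        if q = (l.1, varCol l.2) then (if ((φ.get l.1).lit l.2).1 = x then (1 : K) else 0)
          else 0 := by
      intro l; split_ifs <;> rfl
    simp_rw [this]
    rw [sum_slot_col]
    simp_rw [ite_and]
  simp_rw [e1, e2, Finset.sum_mul_sum]
  rw [Finset.sum_comm]
  refine Finset.sum_congr rfl fun a _ => ?_
  rw [Finset.sum_comm]
  refine Finset.sum_congr rfl fun a' _ => ?_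
  have e3 : ∀ x : Fin t,
      (if p.2 = varRow a ∧ ((φ.get p.1).lit a).1 = x then cv x - ξ (p.1, a) else 0) *
        (if q.2 = varCol a' ∧ ((φ.get q.1).lit a').1 = x then (1 : K) else 0) =
      (fun x => cv x - ξ (p.1, a)) x *
        ((if p.2 = varRow a ∧ ((φ.get p.1).lit a).1 = x then (1 : K) else 0) *
          (if q.2 = varCol a' ∧ ((φ.get q.1).lit a').1 = x then (1 : K) else 0)) := by
    intro x; split_ifs <;> simp
  simp_rw [e3]
  exact sum_mul_ite_eq_ite_eq (fun x => cv x - ξ (p.1, a)) _ _ _ _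


/-! ### The junk identity and the decomposition `pencil = B + W′` -/

/-- Termwise bookkeeping: formula-variable part + auxiliary part = rank-one correction + the
diagonal variable entries of the blocks. [cite: BlaserIkenmeyerJindalLysikov2018, §5 (construction of `T_φ`)] -/
theorem junk_identity (φ : List (Clause₃ t)) (cv : Fin t → K) (ξ : Fin φ.length × Fin 3 → K)
    (p q : Fin φ.length × Fin 9) :
    (∑ a : Fin 3, ∑ a' : Fin 3,
        if p.2 = varRow a ∧ q.2 = varCol a' ∧ ((φ.get q.1).lit a').1 = ((φ.get p.1).lit a).1
        then cv ((φ.get p.1).lit a).1 else 0) +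
      (∑ a : Fin 3, ∑ a' : Fin 3,
        if p.2 = varRow a ∧ q.2 = varCol a' ∧ ((φ.get q.1).lit a').1 = ((φ.get p.1).lit a).1 ∧
            (p.1, a) ≠ (q.1, a')
        then -ξ (p.1, a) else 0) =
    (∑ a : Fin 3, ∑ a' : Fin 3,
        if p.2 = varRow a ∧ q.2 = varCol a' ∧ ((φ.get q.1).lit a').1 = ((φ.get p.1).lit a).1
        then cv ((φ.get p.1).lit a).1 - ξ (p.1, a) else 0) +
      (if p.1 = q.1 then ∑ a : Fin 3, (if p.2 = varRow a ∧ q.2 = varCol a then ξ (p.1, a) else 0)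
        else 0) := by
  have hD : (if p.1 = q.1 then
        ∑ a : Fin 3, (if p.2 = varRow a ∧ q.2 = varCol a then ξ (p.1, a) else 0) else 0) =
      ∑ a : Fin 3, ∑ a' : Fin 3,
        if p.2 = varRow a ∧ q.2 = varCol a' ∧ (p.1, a) = (q.1, a') then ξ (p.1, a) else 0 := by
    by_cases h : p.1 = q.1
    · rw [if_pos h]
      refine Finset.sum_congr rfl fun a _ => ?_
      rw [Finset.sum_eq_single a]
      · simp [h]
      · intro a' _ ha'
        rw [if_neg]
        rintro ⟨-, -, he⟩
        exact ha' (Prod.mk.inj he).2.symm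
      · simp
    · rw [if_neg h]
      symm
      refine Finset.sum_eq_zero fun a _ => Finset.sum_eq_zero fun a' _ => ?_
      rw [if_neg]
      rintro ⟨-, -, he⟩
      exact h (Prod.mk.inj he).1
  rw [hD, ← Finset.sum_add_distrib, ← Finset.sum_add_distrib]
  refine Finset.sum_congr rfl fun a _ => ?_
  rw [← Finset.sum_add_distrib, ← Finset.sum_add_distrib]
  refine Finset.sum_congr rfl fun a' _ => ?_
  by_cases hR : p.2 = varRow a
  · by_cases hC : q.2 = varCol a'
    · simp only [hR, hC, true_and]
      by_cases hE : (p.1, a) = (q.1, a')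
      · have hV : ((φ.get q.1).lit a').1 = ((φ.get p.1).lit a).1 := by
          rw [(Prod.mk.inj hE).1, (Prod.mk.inj hE).2]
        rw [if_pos hV, if_neg (fun h => h.2 hE), if_pos hV, if_pos hE]
        ring
      · by_cases hV : ((φ.get q.1).lit a').1 = ((φ.get p.1).lit a).1
        · rw [if_pos hV, if_pos ⟨hV, hE⟩, if_pos hV, if_neg hE]
          ring
        · rw [if_neg hV, if_neg (fun h => hV h.1), if_neg hV, if_neg hE]
    · simp [hC]
  · simp [hR]

/-- **The decomposition.** At the assignment (formula variables `cv`, virtual slot values `ξ`,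
Lemma-21 locals, auxiliary `x_{h,l} ↦ -ξ_h`) the pencil `A₀ + Σ c_k A_k` of `T_φ` is the block
diagonal matrix of the `9 × 9` gadgets at the virtual values plus the correction
`W′ = Σ_x (cv x - ξ on the x-rows) ⊗ (indicator of the x-columns)`.
[cite: BlaserIkenmeyerJindalLysikov2018, §5 (construction of `T_φ`), Lemma 22 (proof)] -/
theorem pencilEval_tphi_eq (φ : List (Clause₃ t)) (cv : Fin t → K) (ξ : Fin φ.length × Fin 3 → K) :
    pencilEval (tphiA₀ K φ) (tphiSlices K φ)
      (Sum.elim cv (Sum.elim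
        (fun y : Fin φ.length × Fin 3 × Fin 3 =>
          if y.2.2 = 1 then gs K ((φ.get y.1).lit y.2.1).2 (ξ (y.1, y.2.1)) else ξ (y.1, y.2.1))
        (fun σ : (Σ x : Fin t, {pp : Occ φ x × Occ φ x // pp.1 ≠ pp.2}) => -ξ σ.2.1.1.1))) =
    (Matrix.of fun p q : Fin φ.length × Fin 9 =>
        if p.1 = q.1 then
          gadget₉ K ((φ.get p.1).lit 0).2 ((φ.get p.1).lit 1).2 ((φ.get p.1).lit 2).2 (ξ (p.1, 0)) (ξ (p.1, 1)) (ξ (p.1, 2))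
            (ξ (p.1, 0)) (ξ (p.1, 1)) (ξ (p.1, 2)) (gs K ((φ.get p.1).lit 0).2 (ξ (p.1, 0))) (ξ (p.1, 0))
            (gs K ((φ.get p.1).lit 1).2 (ξ (p.1, 1))) (ξ (p.1, 1)) (gs K ((φ.get p.1).lit 2).2 (ξ (p.1, 2))) (ξ (p.1, 2)) p.2 q.2
        else 0) +
    (∑ x : Fin t, Matrix.vecMulVec
        (fun p : Fin φ.length × Fin 9 =>
          ∑ h : Occ φ x, if p = (h.1.1, varRow h.1.2) then cv x - ξ h.1 else 0)
        (fun q : Fin φ.length × Fin 9 =>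
          ∑ l : Occ φ x, if q = (l.1.1, varCol l.1.2) then (1 : K) else 0)) := by
  ext p q
  simp only [pencilEval, Matrix.add_apply, Matrix.sum_apply, Matrix.smul_apply, smul_eq_mul]
  rw [Fintype.sum_sum_type, Fintype.sum_sum_type]
  simp only [Sum.elim_inl, Sum.elim_inr]
  rw [svar_apply, sloc_apply, saux_apply, ← Matrix.sum_apply, wcorr_apply]
  rw [show ∀ a b c d : K, a + (b + (c + d)) = (a + c) + (b + d) from fun a b c d => by ring,
    junk_identity]
  suffices hB : tphiA₀ K φ p q +
      (if p.1 = q.1 then ∑ a : Fin 3, ∑ wh : Fin 3,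
        (if ((p.1, a, wh) : Fin φ.length × Fin 3 × Fin 3).2.2 = 1 then
            gs K ((φ.get ((p.1, a, wh) : Fin φ.length × Fin 3 × Fin 3).1).lit
              ((p.1, a, wh) : Fin φ.length × Fin 3 × Fin 3).2.1).2
              (ξ (((p.1, a, wh) : Fin φ.length × Fin 3 × Fin 3).1,
                ((p.1, a, wh) : Fin φ.length × Fin 3 × Fin 3).2.1))
          else ξ (((p.1, a, wh) : Fin φ.length × Fin 3 × Fin 3).1,
                ((p.1, a, wh) : Fin φ.length × Fin 3 × Fin 3).2.1)) *
        (if wh = 0 then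
          (if (p.2 = varCol a ∨ p.2 = clauseRow a) then
            (if q.2 = varCol a then 1 else if q.2 = clauseRow a then
              (if ((φ.get p.1).lit a).2 then -1 else 1) else 0) else 0)
         else if wh = 1 then (if p.2 = varCol a ∧ q.2 = clauseRow a then -1 else 0)
         else (if p.2 = clauseRow a ∧ q.2 = varCol a then -1 else 0))
      else 0) +
      (if p.1 = q.1 then ∑ a : Fin 3, (if p.2 = varRow a ∧ q.2 = varCol a then ξ (p.1, a) else 0)
        else 0) =
      (Matrix.of fun p q : Fin φ.length × Fin 9 =>
        if p.1 = q.1 then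
          gadget₉ K ((φ.get p.1).lit 0).2 ((φ.get p.1).lit 1).2 ((φ.get p.1).lit 2).2 (ξ (p.1, 0)) (ξ (p.1, 1)) (ξ (p.1, 2))
            (ξ (p.1, 0)) (ξ (p.1, 1)) (ξ (p.1, 2)) (gs K ((φ.get p.1).lit 0).2 (ξ (p.1, 0))) (ξ (p.1, 0))
            (gs K ((φ.get p.1).lit 1).2 (ξ (p.1, 1))) (ξ (p.1, 1)) (gs K ((φ.get p.1).lit 2).2 (ξ (p.1, 2))) (ξ (p.1, 2)) p.2 q.2
        else 0) p q by
    rw [← hB]; ring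
  obtain ⟨j, r⟩ := p
  obtain ⟨j', r'⟩ := q
  by_cases hj : j = j'
  · subst hj
    have hb := block_identity (K := K) (fun a => ((φ.get j).lit a).2) (fun a => ξ (j, a)) r r'
    simp only [tphiA₀, if_true, Matrix.of_apply]
    exact hb
  · simp [tphiA₀, hj, Matrix.of_apply]


/-! ### Rank bounds -/

/-- Embedding a `9 × 9` block on the diagonal does not increase the rank. [folklore] -/
private theorem rank_blockEmbed_le (s : ℕ) (j : Fin s) (M : Matrix (Fin 9) (Fin 9) K) :
    (Matrix.of fun p q : Fin s × Fin 9 => if p.1 = j ∧ q.1 = j then M p.2 q.2 else 0).rank ≤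
      M.rank := by
  have h1 : (Matrix.of fun p q : Fin s × Fin 9 => if p.1 = j ∧ q.1 = j then M p.2 q.2 else 0) =
      (Matrix.of fun (p : Fin s × Fin 9) (r : Fin 9) => if p.1 = j ∧ p.2 = r then (1 : K) else 0) * M *
        (Matrix.of fun (p : Fin s × Fin 9) (r : Fin 9) => if p.1 = j ∧ p.2 = r then (1 : K) else 0)ᵀ := by
    ext p q
    rw [Matrix.of_apply, Matrix.mul_apply]
    simp_rw [Matrix.mul_apply, Matrix.transpose_apply, Matrix.of_apply]
    by_cases hp : p.1 = j
    · by_cases hq : q.1 = j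
      · simp [hp, hq, ite_mul, mul_ite]
      · simp [hp, hq, ite_mul]
    · simp [hp]
  rw [h1]
  exact (Matrix.rank_mul_le_left _ _).trans (Matrix.rank_mul_le_right _ _)

/-- The block diagonal part has rank at most `5 s` when every block is a gadget at virtually
satisfying values (Lemma 21 (1)). [cite: BlaserIkenmeyerJindalLysikov2018, Lemma 21 (1), Lemma 22 (1) (proof)] -/
theorem rank_blockDiag_le (φ : List (Clause₃ t)) (ξ : Fin φ.length × Fin 3 → K)
    (hsat : ∀ j : Fin φ.length, SatisfiesLit K ((φ.get j).lit 0).2 (ξ (j, 0)) ∨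
      SatisfiesLit K ((φ.get j).lit 1).2 (ξ (j, 1)) ∨ SatisfiesLit K ((φ.get j).lit 2).2 (ξ (j, 2))) :
    (Matrix.of fun p q : Fin φ.length × Fin 9 =>
        if p.1 = q.1 then
          gadget₉ K ((φ.get p.1).lit 0).2 ((φ.get p.1).lit 1).2 ((φ.get p.1).lit 2).2 (ξ (p.1, 0)) (ξ (p.1, 1)) (ξ (p.1, 2))
            (ξ (p.1, 0)) (ξ (p.1, 1)) (ξ (p.1, 2)) (gs K ((φ.get p.1).lit 0).2 (ξ (p.1, 0))) (ξ (p.1, 0))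
            (gs K ((φ.get p.1).lit 1).2 (ξ (p.1, 1))) (ξ (p.1, 1)) (gs K ((φ.get p.1).lit 2).2 (ξ (p.1, 2))) (ξ (p.1, 2)) p.2 q.2
        else 0).rank ≤ 5 * φ.length := by
  have hB : (Matrix.of fun p q : Fin φ.length × Fin 9 =>
        if p.1 = q.1 then
          gadget₉ K ((φ.get p.1).lit 0).2 ((φ.get p.1).lit 1).2 ((φ.get p.1).lit 2).2 (ξ (p.1, 0)) (ξ (p.1, 1)) (ξ (p.1, 2))
            (ξ (p.1, 0)) (ξ (p.1, 1)) (ξ (p.1, 2)) (gs K ((φ.get p.1).lit 0).2 (ξ (p.1, 0))) (ξ (p.1, 0))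
            (gs K ((φ.get p.1).lit 1).2 (ξ (p.1, 1))) (ξ (p.1, 1)) (gs K ((φ.get p.1).lit 2).2 (ξ (p.1, 2))) (ξ (p.1, 2)) p.2 q.2
        else 0) =
      ∑ j : Fin φ.length, Matrix.of fun p q : Fin φ.length × Fin 9 =>
        if p.1 = j ∧ q.1 = j then
          gadget₉ K ((φ.get j).lit 0).2 ((φ.get j).lit 1).2 ((φ.get j).lit 2).2 (ξ (j, 0)) (ξ (j, 1)) (ξ (j, 2))
            (ξ (j, 0)) (ξ (j, 1)) (ξ (j, 2)) (gs K ((φ.get j).lit 0).2 (ξ (j, 0))) (ξ (j, 0))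
            (gs K ((φ.get j).lit 1).2 (ξ (j, 1))) (ξ (j, 1)) (gs K ((φ.get j).lit 2).2 (ξ (j, 2))) (ξ (j, 2)) p.2 q.2
        else 0 := by
    ext p q
    simp only [Matrix.of_apply, Matrix.sum_apply, ite_and]
    rw [Finset.sum_ite_eq]
    simp only [Finset.mem_univ, if_true]
    by_cases h : p.1 = q.1
    · rw [if_pos h, if_pos h.symm, h]
    · rw [if_neg h, if_neg (Ne.symm h)]
  rw [hB]
  refine (rank_sum_le _ _).trans ?_
  calc ∑ j : Fin φ.length, (Matrix.of fun p q : Fin φ.length × Fin 9 =>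
        if p.1 = j ∧ q.1 = j then
          gadget₉ K ((φ.get j).lit 0).2 ((φ.get j).lit 1).2 ((φ.get j).lit 2).2 (ξ (j, 0)) (ξ (j, 1)) (ξ (j, 2))
            (ξ (j, 0)) (ξ (j, 1)) (ξ (j, 2)) (gs K ((φ.get j).lit 0).2 (ξ (j, 0))) (ξ (j, 0))
            (gs K ((φ.get j).lit 1).2 (ξ (j, 1))) (ξ (j, 1)) (gs K ((φ.get j).lit 2).2 (ξ (j, 2))) (ξ (j, 2)) p.2 q.2
        else 0).rank
      ≤ ∑ _j : Fin φ.length, 5 := Finset.sum_le_sum fun j _ =>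
        (rank_blockEmbed_le φ.length j _).trans
          (Lemma21.rank_gadget₉_eq_five _ _ _ _ _ _ (hsat j)).le
    _ = 5 * φ.length := by simp [mul_comm]

/-- The correction `W′` is a sum of `t` rank-one matrices. [cite: BlaserIkenmeyerJindalLysikov2018, §5 (construction of `T_φ`)] -/
theorem rank_wcorr_le (φ : List (Clause₃ t)) (cv : Fin t → K) (ξ : Fin φ.length × Fin 3 → K) :
    (∑ x : Fin t, Matrix.vecMulVec
        (fun p : Fin φ.length × Fin 9 =>
          ∑ h : Occ φ x, if p = (h.1.1, varRow h.1.2) then cv x - ξ h.1 else 0)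
        (fun q : Fin φ.length × Fin 9 =>
          ∑ l : Occ φ x, if q = (l.1.1, varCol l.1.2) then (1 : K) else 0)).rank ≤ t := by
  refine (rank_sum_le _ _).trans ?_
  calc ∑ x : Fin t, (Matrix.vecMulVec
        (fun p : Fin φ.length × Fin 9 =>
          ∑ h : Occ φ x, if p = (h.1.1, varRow h.1.2) then cv x - ξ h.1 else 0)
        (fun q : Fin φ.length × Fin 9 =>
          ∑ l : Occ φ x, if q = (l.1.1, varCol l.1.2) then (1 : K) else 0)).rank
      ≤ ∑ _x : Fin t, 1 := Finset.sum_le_sum fun x _ => Matrix.rank_vecMulVec_le _ _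
    _ = t := by simp

/-- The correction `W′` vanishes when the virtual values are the actual variable values.
[cite: BlaserIkenmeyerJindalLysikov2018, Lemma 22 (1) (proof)] -/
theorem wcorr_eq_zero (φ : List (Clause₃ t)) (cv : Fin t → K) (ξ : Fin φ.length × Fin 3 → K)
    (hcons : ∀ h : Fin φ.length × Fin 3, ξ h = cv ((φ.get h.1).lit h.2).1) :
    (∑ x : Fin t, Matrix.vecMulVec
        (fun p : Fin φ.length × Fin 9 =>
          ∑ h : Occ φ x, if p = (h.1.1, varRow h.1.2) then cv x - ξ h.1 else 0)
        (fun q : Fin φ.length × Fin 9 =>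
          ∑ l : Occ φ x, if q = (l.1.1, varCol l.1.2) then (1 : K) else 0)) = 0 := by
  refine Finset.sum_eq_zero fun x _ => ?_
  have : (fun p : Fin φ.length × Fin 9 =>
      ∑ h : Occ φ x, if p = (h.1.1, varRow h.1.2) then cv x - ξ h.1 else 0) = 0 := by
    funext p
    refine Finset.sum_eq_zero fun h _ => ?_
    rw [hcons h.1, h.2, sub_self, ite_self]
  rw [this]
  ext p q
  simp [Matrix.vecMulVec_apply]

/-- **Rank of the pencil at the cheating assignment**: at most `5 s + t`.
[cite: BlaserIkenmeyerJindalLysikov2018, Lemma 22 (erratum: upper bound for every 3-CNF)] -/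
theorem rank_pencilEval_le (φ : List (Clause₃ t)) (cv : Fin t → K) (ξ : Fin φ.length × Fin 3 → K)
    (hsat : ∀ j : Fin φ.length, SatisfiesLit K ((φ.get j).lit 0).2 (ξ (j, 0)) ∨
      SatisfiesLit K ((φ.get j).lit 1).2 (ξ (j, 1)) ∨ SatisfiesLit K ((φ.get j).lit 2).2 (ξ (j, 2))) :
    (pencilEval (tphiA₀ K φ) (tphiSlices K φ)
      (Sum.elim cv (Sum.elim
        (fun y : Fin φ.length × Fin 3 × Fin 3 =>
          if y.2.2 = 1 then gs K ((φ.get y.1).lit y.2.1).2 (ξ (y.1, y.2.1)) else ξ (y.1, y.2.1))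
        (fun σ : (Σ x : Fin t, {pp : Occ φ x × Occ φ x // pp.1 ≠ pp.2}) => -ξ σ.2.1.1.1)))).rank ≤ 5 * φ.length + t := by
  rw [pencilEval_tphi_eq]
  exact (rank_add_le _ _).trans (add_le_add (rank_blockDiag_le φ ξ hsat) (rank_wcorr_le φ cv ξ))

/-- **Rank of the pencil at a consistent assignment** (virtual values = variable values): at most
`5 s`. [cite: BlaserIkenmeyerJindalLysikov2018, Lemma 22 (1) (proof)] -/
theorem rank_pencilEval_le_of_consistent (φ : List (Clause₃ t)) (cv : Fin t → K)
    (ξ : Fin φ.length × Fin 3 → K)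
    (hsat : ∀ j : Fin φ.length, SatisfiesLit K ((φ.get j).lit 0).2 (ξ (j, 0)) ∨
      SatisfiesLit K ((φ.get j).lit 1).2 (ξ (j, 1)) ∨ SatisfiesLit K ((φ.get j).lit 2).2 (ξ (j, 2)))
    (hcons : ∀ h : Fin φ.length × Fin 3, ξ h = cv ((φ.get h.1).lit h.2).1) :
    (pencilEval (tphiA₀ K φ) (tphiSlices K φ)
      (Sum.elim cv (Sum.elim
        (fun y : Fin φ.length × Fin 3 × Fin 3 =>
          if y.2.2 = 1 then gs K ((φ.get y.1).lit y.2.1).2 (ξ (y.1, y.2.1)) else ξ (y.1, y.2.1))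
        (fun σ : (Σ x : Fin t, {pp : Occ φ x × Occ φ x // pp.1 ≠ pp.2}) => -ξ σ.2.1.1.1)))).rank ≤ 5 * φ.length := by
  rw [pencilEval_tphi_eq, wcorr_eq_zero φ cv ξ hcons, add_zero]
  exact rank_blockDiag_le φ ξ hsat

/-- A `{0,1}`-value matching the polarity satisfies the literal. [cite: BlaserIkenmeyerJindalLysikov2018, Lemma 21] -/
theorem satisfiesLit_ite (pos : Bool) : SatisfiesLit K pos (if pos then 1 else 0) := by
  cases pos
  · exact Or.inr ⟨by simp, rfl⟩
  · exact Or.inl ⟨by simp, rfl⟩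

/-- A true literal under a Boolean assignment, read as a `{0,1}`-value, satisfies the literal.
[cite: BlaserIkenmeyerJindalLysikov2018, Lemma 21] -/
theorem satisfiesLit_of_eval {ν : Type*} (σ : ν → Bool) (l : Literal ν) (h : l.eval σ = true) :
    SatisfiesLit K l.2 (if σ l.1 then 1 else 0) := by
  have h' : σ l.1 = l.2 := by simpa [Literal.eval] using h
  rw [h']
  exact satisfiesLit_ite l.2

end Lemma22

open Lemma22

/-! ### The results -/

variable {t : ℕ}

variable (K) in
/-- **Completion rank of `T_φ` is at most `5 s + t` for EVERY 3-CNF `φ`** (`s` clauses,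
`t` variables), satisfiable or not: formula variables `↦ 0`, each slot gets the virtual value
satisfying its own literal, locals as in Lemma 21 (1), auxiliary `x_{h,l} ↦ -`(virtual value of
`h`); the pencil is then (block diagonal of rank-5 gadgets) + (one rank-one matrix per variable).
[cite: BlaserIkenmeyerJindalLysikov2018, Lemma 22 (erratum)] -/
theorem completionRank_tphi_le (φ : List (Clause₃ t)) :
    completionRank (tphiA₀ K φ) (tphiSlices K φ) ≤ 5 * φ.length + t := by
  refine (completionRank_le _ _ _).trans
    (rank_pencilEval_le (K := K) φ (fun _ => 0)
      (fun h => if ((φ.get h.1).lit h.2).2 then 1 else 0) fun j => Or.inl (satisfiesLit_ite _))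

variable (K) in
/-- **BIJL Lemma 22, part (1) — PROVED.** If `φ` is satisfiable then `CR(T_φ) ≤ 5 s`: the
satisfying assignment as values, Lemma 21 (1) locals, auxiliary variables clearing the off-block
entries. [cite: BlaserIkenmeyerJindalLysikov2018, Lemma 22 (1)] -/
theorem completionRank_tphi_le_of_satisfiable (φ : List (Clause₃ t))
    (hφ : ∃ σ : Fin t → Bool, numSat₃ φ σ = φ.length) :
    completionRank (tphiA₀ K φ) (tphiSlices K φ) ≤ 5 * φ.length := by
  obtain ⟨σ, hσ⟩ := hφ
  have hall : ∀ j : Fin φ.length, SatisfiesLit K ((φ.get j).lit 0).2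
        (if σ ((φ.get j).lit 0).1 then 1 else 0) ∨
      SatisfiesLit K ((φ.get j).lit 1).2 (if σ ((φ.get j).lit 1).1 then 1 else 0) ∨
      SatisfiesLit K ((φ.get j).lit 2).2 (if σ ((φ.get j).lit 2).1 then 1 else 0) := by
    intro j
    have hmem := List.countP_eq_length.1 hσ (φ.get j) (List.get_mem φ j)
    simp only [Bool.or_eq_true] at hmem
    rcases hmem with (h1 | h2) | h3
    · exact Or.inl (by simpa [Clause₃.lit] using satisfiesLit_of_eval (K := K) σ _ h1)
    · exact Or.inr (Or.inl (by simpa [Clause₃.lit] using satisfiesLit_of_eval (K := K) σ _ h2))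
    · exact Or.inr (Or.inr (by simpa [Clause₃.lit] using satisfiesLit_of_eval (K := K) σ _ h3))
  exact (completionRank_le _ _ _).trans
    (rank_pencilEval_le_of_consistent (K := K) φ (fun x => if σ x then 1 else 0)
      (fun h => if σ ((φ.get h.1).lit h.2).1 then 1 else 0) hall fun h => rfl)

variable (K) in
/-- **The typed `BIJL2018_lemma22` is false (its part (2)), over every field.** Witness:
`t = 1`, `φ₄ = [x∨x∨x, x∨x∨x, ¬x∨¬x∨¬x, ¬x∨¬x∨¬x]` (`s = 4`), `ε = 1/2`: every Boolean
assignment satisfies exactly `2 = (1 - ε) s` clauses, so part (2) demands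
`(5 + ε) s = 22 ≤ CR(T_{φ₄})`, but `CR(T_{φ₄}) ≤ 5 s + t = 21` (`completionRank_tphi_le`).
Erratum note: the printed Lemma 22 (2) is stated for the `T_φ` of an arbitrary 3-CNF and its
printed proof (column exchange, ECCC p. 16) does not account for the virtual values above; with
the bounded-occurrence promise of the source problem of Thm. 20 (each variable in `≤ c`
clauses, so `t ≥ 3s/c`) the bound `5 s + t` does not contradict (2) for `ε ≤ 3/c` — whether
(2) holds there is not decided here. Part (1) holds (`completionRank_tphi_le_of_satisfiable`).
[cite: BlaserIkenmeyerJindalLysikov2018, Lemma 22 (2) (refuted as printed for general 3-CNF)] -/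
theorem not_BIJL2018_lemma22 : ¬ BIJL2018_lemma22 K := by
  intro h
  set φ₄ : List (Clause₃ 1) :=
    [((0, true), (0, true), (0, true)), ((0, true), (0, true), (0, true)),
     ((0, false), (0, false), (0, false)), ((0, false), (0, false), (0, false))] with hφ₄
  have hlen : φ₄.length = 4 := by simp [hφ₄]
  have h2 := (h 1 φ₄ (1 / 2) (by norm_num)).2
  have hlenQ : ((φ₄.length : ℕ) : ℚ) = 4 := by exact_mod_cast hlen
  have hyp : ∀ σ : Fin 1 → Bool, (numSat₃ φ₄ σ : ℚ) ≤ (1 - 1 / 2) * (φ₄.length : ℕ) := by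
    intro σ
    have hval : numSat₃ φ₄ σ = 2 := by
      cases hσ : σ 0 <;> simp [numSat₃, hφ₄, Literal.eval, hσ]
    rw [hval, hlenQ]
    norm_num
  have hlow := h2 hyp
  have hup : ((completionRank (tphiA₀ K φ₄) (tphiSlices K φ₄) : ℕ) : ℚ) ≤
      ((5 * φ₄.length + 1 : ℕ) : ℚ) := by
    exact_mod_cast completionRank_tphi_le (K := K) φ₄
  push_cast at hup
  rw [hlenQ] at hlow hup
  linarith

end Literature.Barriers.ValiantsHypothesis

end
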